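import Literature.MathematicalPhysics.QuantumFieldTheory.Balaban1983to89.B8Thm2TorusCoverOfEBlockSym
import Literature.MathematicalPhysics.QuantumFieldTheory.Balaban1983to89.B9B8KnitBondWordDiffAtPars
import Literature.MathematicalPhysics.QuantumFieldTheory.Balaban1983to89.B8Thm2SetupTorusOfCubes

/-!
# [B8] Thm 2 on the torus — the cover-torus interface with the binder AT `parSymY` and the junction (J) DISCHARGED ((T) FILE 5)

T. Bałaban, *Averaging operations for lattice gauge theories*, Commun. Math. Phys. **98** (1985) 17–51 [`Balaban1985Averaging`, "[B7]"]; *Spaces of regular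
gauge field configurations on a lattice and gauge fixing conditions*, Commun. Math. Phys. **99** (1985) 75–102 [`Balaban1985RegularSpaces`, "[B8]"]; *Propagators
for lattice gauge theories in a background field*, Commun. Math. Phys. **99** (1985) 389–434 [`Balaban1985BackgroundPropagators`, "[B9]"]; *Propagators and
renormalization transformations for lattice gauge theories. II*, Commun. Math. Phys. **96** (1984) 223–250 [`Balaban1984PropagatorsII`, "[4]"].
statement-level skeleton of published theorems with citation tags; proofs where landed; nothing here is a claim about the Yang–Mills mass gap

THE PRINT.  [B8] Thm 2 p. 83 with (1.33)–(1.39) pp. 82–83, (1.7) p. 77 («Ω_j = T_η»), Prop. 6 p. 99; [B9] (3.19) p. 393 vs (3.40) p. 397 (print has ONE transporter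
convention — the junction between def-Y's letter of record `parSymY` and print's knit letter `parKnitY` is a formalisation artefact), (3.25)–(3.27) p. 394–395,
Thm 3.1 (3.42) p. 397, (3.47) p. 398, Thm 3.2 (3.48) p. 398, (3.49) p. 399, Thm 3.3 p. 399, (3.101) p. 414, (3.106) p. 414, Thm 3.11 p. 416; [4] (2.50)–(2.55) p. 232,
Lemma 2.1 (2.60)–(2.61) p. 234, (2.66)–(2.67) p. 234; [B7] (52)–(53) pp. 26–27.

WHY THIS FILE (cell `lit-balaban`; seat t2s-1 gen 10; lead g34 RULING JUNCTION-PARS (T) CONFIRMED 2026-08-28T23:20Z).  t2s-1's FILE 4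
(`B8Thm2TorusCoverOfEBlockSym`) states the torus Thm 2 interface of record with the binder at def-Y's letter `parSymY`, displaying per shape-member (1ₛ)
`IsUnit Δ_a(U; parSymY)`, (Eₛ) the E-block of the `GAY(parSymY)` kernel family (M5.7's endpoint currency VERBATIM) and (J) the junction inequality
`|(D_UP_SD*_U − D_UP_KD*_U)A|₍₋₃₎ ≤ κ|A|₍₋₁₎`.  THIS FILE DISCHARGES (J): by t2s-1's 5b (`B9B8KnitBondWordDiffAtPars.hasMajorant_conj_DPDsY_sub_pars`, = p38's 2b at the
two tables with 2c-i's `G′`-sector and 5a's `Q′ ∕ C`-sector) and p38's 2b §3 (`wNormBY_apply_le_of_hasMajorant`), (J) holds at every shape-member's background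
`bgY i U₀` with the EXPLICIT constant `κ′ = κ_J·M₂Σ‖b_j‖·Λ_W·c₁(d_W,δ_W₂,α_W₂)`, `κ_J = O(α₀′)`, from def-Y's-side data ONLY — M5.5's (3.42)₁ majorant of `conj b(η²G′_S)`
with its `d + 1` directional left ∕ right derivative products and M5.6's (3.48) majorant of `conj b(η⁻⁴X_S⁻¹)`, at `U = bgY i U₀`, for every section `ιB` of the
block chart — once [B7]'s class (52) holds for `bgY i U₀` at the member's finest scale `k = m′ + 1`: this is the consumer's (1.7) `U₀ ∈ 𝔄_{m′}(T_η, α₀)`, `α₀ ≤ a_T`,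
read one level up (A9's `pdev_liftCfg_bgY_lt_of_inAk`, slack window `a_T·L² < α₀′`), `G = U(N)` being averaging-closed (`avgClosed_unitaryUnits`).  The binder
therefore displays (1ₛ) ∧ (Eₛ) ∧ (Dₛ) with (Dₛ) = def-Y's-side block-majorant data (M5.5 ∕ M5.6 output shapes, p33's lineage), the members' walk geometry at the
junction's rate ladder (`hgeoJ`, 22 facts per member: (2.54), `d(y,y) = 0`, (2.61)∕(2.63), scale transfers of `ℓ, ℓ², ℓ⁻¹, ℓ⁻⁴`), and the numeric windows
(class (52) size, J-B file 9's and 23c's smallness, FILE 4's junction window at `κ′`) as explicit hypotheses.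

WHAT THIS FILE PROVES (THEOREMS; 0 `def`, 0 `def … : Prop`, 0 sorry; standard axioms).
* §1 `shiftCfg_of_isPeriodic` (bookkeeping), ★★ `jAt_of_symData` — (J) at ONE shape-member from (Dₛ), the class (1.7) one level up, `hgeoJ`, the windows.
* §2 ★★ `jBinder_of_symBinder` — FILE 4's binder [(1ₛ) ∧ (Eₛ) ∧ (J at `κ′`)] from the binder [(1ₛ) ∧ (Eₛ) ∧ (Dₛ)], member by member.
* §3 ★★★ `deltaAFour_of_eBlockSymData` — FILE 4 §2 with (J) discharged: the four (Δa)-members at `parKnitY` at `2B_Ec₁L⁴`.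
* §4 ★★★★★ `hThm2Cover_of_prop6_eBlockSymData` — THE INTERFACE OF RECORD, `d + 1 = 3`, `N = 2`: `∃ a₀′ > 0, ∃ k₀, ∃ c_α > 0, ∀ c_L …, ∃ B₁ B₂ c₁ > 0, ∀ F : T3Family,
  F.L = ℓ+1 → ∀ n < K`, [(1ₛ) ∧ (Eₛ) ∧ (Dₛ) at the cover torus' shape-members] → `P ∣ P′ ∧ L^{K−n} ∣ P ∧ Thm2TorusAt (ℓ+1) (K−n) P′ (eta F n K) 0 B₁ B₂ c₁ len SU(2) ⊤`.

HONEST SCOPE ∕ NOT CLAIMED.  (1ₛ), (Eₛ) (M5.7's endpoint at `parSymY`, p33 ∕ p38 lineages), (Dₛ) (M5.5 ∕ M5.6 output shapes), `hgeo`, `hgeoJ` and the windows are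
DISPLAYED hypotheses (sockets), not discharged here; the constants are explicit, not optimised; `G = U(N)`-valued backgrounds (the `SU(2)` of the conclusion is
FILE 4's).  `stub_PV3A` is NOT discharged; no summit ∕ sub-problem ∕ node statement is proved; nothing continuum ∕ ℝ⁴ ∕ OS — the Yang–Mills mass gap is NOT
proved by any of this (Track A conditional rung).  No `sorry`, no `axiom`, no `… : Prop` fact, no `instance`, no `notation`, no `def`.  NEW file; nothing landed
is modified.  `--supports stmt-QuantumFields-19200` as helper.  Net new unproved facts: 0.

RELATED IN THE TREE, NOT DUPLICATED (searched 2026-08-29: `rg 'SymData|symBinder|EBlockSymJ' Literature/` = ∅): FILE 4 (the (J)-displayed interface; USED BY NAME),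
5b ∕ 2b §3 (USED BY NAME), A9 `B8Thm2SetupTorusOfCubes.pdev_liftCfg_bgY_lt_of_inAk` (USED BY NAME), `B8Thm2TorusKnitOfCubeData` (the knit lineage's from-cube-data
torus supplier at print's letters — a different input list).
-/

noncomputable section

namespace Literature.MathematicalPhysics.QuantumFieldTheory.Balaban1983to89.B8Thm2TorusCoverOfEBlockSymJ

open scoped BigOperators
open Node00 B6KLevelCensusIndexV1
open B7Prop1Explicit renaming Site → LSite
open B7Prop1Explicit (e)
open B7Prop2Explicit (unitaryUnits C0 c2' avgClosed_unitaryUnits pdev)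
open B6GlobalChartV1 (PV blkV1)
open B6Geom246MultiLevelBox (blkOf)
open B6Ineq2142KLevelV1 (β)
open B6RandomWalk (HasMajorant Ineq260 Ineq261 Ineq263 Triangle254 c1_nonneg)
open B9Thm34Ext (toB6)
open B9FromB6 (EBlock)
open B9CubeLettersInvReadings (kernelFamilyBInv)
open B9GeoNormsKLevelV1 (geo9K)
open B9Ineq347 (ScaleTransfer)
open B9Eq352DivFormLetters (conj)
open B9Eq352GradLetters (diffLetter)
open B9Eq3104CutoffCommutators (DPDsY)
open B8Thm2TorusCoverOfEBlock (surjective_beta_kIdx_of_constLev)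
open B8Thm2TorusCoverOfEBlockSym (deltaAFour_of_eBlockSym hThm2Cover_of_prop6_eBlockSym)
open B9B8KnitBondWordDiff (wNormBY_apply_le_of_hasMajorant)
open B9B8KnitBondWordDiffAtPars (hasMajorant_conj_DPDsY_sub_pars kappaJ_nonneg)
open B9B8CarrierDictionary (liftCfg)
open B8Thm2SetupTorusOfCubes (pdev_liftCfg_bgY_lt_of_inAk)
open B12Ineq417Flat (shiftCfg shiftCfg_apply)
open B8Ineq132 (InAk)
open B8Thm2TorusLettersPerOfKnit (bgY bgY_mem)
open B9B8AveragingJunction (parKnitY)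
open B9Eq316AveragingTransposeZd (betaTau alphaQ)
open B7Prop2SpecialUnitary (specialUnitaryUnits)
open B8Thm2TorusAt (Thm2TorusAt)
open T4TermwiseTorus (IsPeriodic)
open scoped Matrix Matrix.Norms.L2Operator

variable {d ℓ : ℕ} {hd : 1 ≤ d + 1} {hL : Odd (ℓ + 1) ∧ 1 < ℓ + 1} {b₀ b₁ : ℝ} {N : ℕ}

/-! ## §1  (J) at ONE shape-member from def-Y's-side data -/

section Member

omit hd hL in
/-- the lattice form of periodicity gives the per-direction `shiftCfg` form. [cite: Balaban1985RegularSpaces, p.77 («Ω₀ = T_η»), bookkeeping] -/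
theorem shiftCfg_of_isPeriodic {β' : Type*} {P : ℕ} {F : LSite (d + 1) → β'} (h : IsPeriodic P F) :
    ∀ μ : Fin (d + 1), shiftCfg (((P : ℕ) : ℤ) • e μ) F = F :=
  fun μ => funext fun x => by rw [shiftCfg_apply]; exact h x (e μ)

/-- ★★ **(J) AT ONE SHAPE-MEMBER FROM def-Y's-SIDE DATA.**  A member `i` of constant level `n` (`k = n + 1`, `c_f = L^{n+1}`), a `U(N)`-valued background `U₀`,
periodic for the member's torus, in the consumer's class (1.7) `𝔄_n(T_η, α₀)` with `0 < α₀ ≤ a_T`; the class parameter `α₀′` one level up (`a_T·L² < α₀′`, `C₀α₀′ ≤ ⅓`,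
`2α₀′ ≤ c₂′`); a real basis `b` with coordinate bound `M₂`; def-Y's-side data (Dₛ) at `bgY i U₀` for EVERY section `ιB` of the block chart (M5.5's `Aℓ²e^{−δ₀d}`, its
`d + 1` left ∕ right derivative products `A₁ℓe^{−δ₀d}`, `A₂ℓe^{−δ₀d}`, M5.6's `K(ℓ⁴)⁻¹e^{−δ₀d}`); the member's walk geometry at the junction's ladder (`hgeoJ`, 22 facts);
the budgets and windows of 5b and 2b §3.  THEN `|(D_UP_SD*_U − D_UP_KD*_U)A|₍₋₃₎ ≤ (κ_J·M₂Σ‖b_j‖·Λ_W·c₁(d_W,δ_W₂,α_W₂))·|A|₍₋₁₎` at `U = bgY i U₀` for every bond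
function `A` — FILE 4's (J) with an explicit `O(α₀′)` constant.  (The section is A11's, from the member's constant level; the class (52) at scale `k` is A9's
`pdev_liftCfg_bgY_lt_of_inAk`; `U(N)` is averaging-closed.)
[cite: Balaban1985BackgroundPropagators, (3.25)–(3.27) p.394–395, (3.49) p.399, (3.39)–(3.42) p.397, (3.47)–(3.48) p.398, (3.19) p.393, (3.106) p.414; Balaban1984PropagatorsII, (2.50)–(2.55) p.232, Lemma 2.1 (2.60)–(2.61) p.234; Balaban1985RegularSpaces, (1.7) p.77; Balaban1985Averaging, (52)–(53) pp.26–27] -/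
theorem jAt_of_symData [Nonempty (Fin N)] (i : KIdx d ℓ hd hL b₀ b₁) [Fintype (geo9K i).Site] [DecidableEq (geo9K i).Site]
    {n : ℕ} (hk : i.k = n + 1) (hD : ∀ x, i.D.lev x = n) (hcf : i.cf = (((ℓ + 1 : ℕ) : ℝ)) ^ (n + 1))
    {η aT α₀ : ℝ} {U₀ : LSite (d + 1) → Fin (d + 1) → (Matrix (Fin N) (Fin N) ℂ)ˣ} (hU₀ : ∀ x κ, U₀ x κ ∈ unitaryUnits (Matrix (Fin N) (Fin N) ℂ))
    (hper : ∀ μ : Fin (d + 1), shiftCfg ((((PV d ℓ i.m i.K hd hL).sitesPerDir 0 : ℕ) : ℤ) • e μ) U₀ = U₀)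
    (hα0 : 0 < α₀) (hαT : α₀ ≤ aT) (hIn : InAk (ℓ + 1) n η α₀ (fun _ => (Set.univ : Set (LSite (d + 1)))) U₀)
    {Rg : ℝ} {Hg : Prop}
    {ι : Type} [Fintype ι] [DecidableEq ι] (b : Module.Basis ι ℝ (Matrix (Fin N) (Fin N) ℂ)) {M₂ : ℝ} (hM₂ : 0 ≤ M₂)
    (hrepr : ∀ (v : (Matrix (Fin N) (Fin N) ℂ)) (j : ι), |b.repr v j| ≤ M₂ * ‖v‖)
    -- the class parameter of [B7] (52) at the members' finest scale, one level above the consumer's (1.7)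
    {α₀' : ℝ} (hα₀ : 0 < α₀') (hα₀3 : C0 (d + 1) * α₀' ≤ 1 / 3) (hα₀2 : 2 * α₀' ≤ c2' (d + 1) (ℓ + 1))
    (hslack : aT * (((ℓ + 1 : ℕ) : ℝ)) ^ (2 * 1) < α₀')
    -- def-Y's-side constants (M5.5: `A, A₁, A₂`; M5.6: `K`) at the rate `δ₀`, and J-B file 9's window
    {δ₀ A A₁ A₂ KT : ℝ} (hA : 0 ≤ A) (hA₁ : 0 ≤ A₁) (hA₂ : 0 ≤ A₂) (hK : 0 ≤ KT)
    (dg : ℕ) {αg : ℝ} (hαδg : 0 ≤ (1 - αg) * δ₀) (hαδg' : 0 ≤ αg * δ₀)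
    {θE AK : ℝ} (hθE : θE = 32 * ((d : ℝ) + 1) ^ 2 * α₀' * (M₂ * ∑ j, ‖b j‖))
    (hAK : AK = A * B6.c1 dg δ₀ αg * (1 - θE * A * B6.c1 dg δ₀ αg)⁻¹) (hsmallg : θE * A * B6.c1 dg δ₀ αg < 1)
    -- the common rate `δ_c` and the entry differences' Lemma 2.1
    (db : ℕ) {δc δb αb βb Λ : ℝ} (hΛ : 0 ≤ Λ) (hδc : 0 ≤ δc) (hαb : 0 ≤ αb) (hβb : 0 ≤ βb) (hδb : 0 ≤ δb)
    (hrb : δc + (αb + βb) * δb ≤ (1 - αg) * δ₀)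
    -- 5a's ladder for the `C`-letters
    (d₁ d₂ d₃ d₄ : ℕ) {δ δ₁ δ₂ δ₃ αst α' αC C C₄ : ℝ} (hδ : δ ≤ (1 - αg) * δ₀)
    (hδ₁ : δ₁ = (1 - α') * ((1 - αst) * δ)) (hδ₂ : δ₂ = (1 - α') * ((1 - αst) * δ₁)) (hδ₃ : δ₃ = (1 - α') * ((1 - αst) * δ₂))
    (hC : 0 ≤ C) (hC₄ : 0 ≤ C₄) (hαδ : 0 ≤ αst * δ) (hα'0 : 0 ≤ α') (hα'1 : α' ≤ 1) (hδ' : 0 ≤ (1 - αst) * δ)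
    (hαδ₂ : 0 ≤ αst * δ₁) (hδ'₂ : 0 ≤ (1 - αst) * δ₁) (hαδ₃ : 0 ≤ αst * δ₂) (hδ'₃ : 0 ≤ (1 - αst) * δ₂) (hαC0 : 0 ≤ αC)
    (hαδ₄ : 0 ≤ (1 - αC) * δ₃)
    {θF : ℝ} (hθF : θF = (2 * (8 * ((d : ℝ) + 1) ^ 2 * α₀') * (M₂ * ∑ j, ‖b j‖)) * (M₂ * ∑ j, ‖b j‖) * (A * A * C * B6.c1 d₁ ((1 - αst) * δ) α') +
          (M₂ * ∑ j, ‖b j‖) * (M₂ * ∑ j, ‖b j‖) * ((A + AK) * (AK * (θE * A) * C * B6.c1 d₁ ((1 - αst) * δ) α') * C * B6.c1 d₂ ((1 - αst) * δ₁) α') +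
          (M₂ * ∑ j, ‖b j‖) * ((2 * (8 * ((d : ℝ) + 1) ^ 2 * α₀') * (M₂ * ∑ j, ‖b j‖))) * (AK * AK * C * B6.c1 d₁ ((1 - αst) * δ) α'))
    (hsmall : θF * KT * C₄ * B6.c1 d₃ ((1 - αst) * δ₂) α' * B6.c1 d₄ δ₃ αC < 1)
    {KK : ℝ} (hKK : KK = KT * B6.c1 d₄ δ₃ αC * (1 - θF * KT * C₄ * B6.c1 d₃ ((1 - αst) * δ₂) α' * B6.c1 d₄ δ₃ αC)⁻¹)
    (d₅ : ℕ) {δ₅ α₅ β₅ Λ₄ : ℝ} (hΛ₄ : 1 ≤ Λ₄) (hα₅ : 0 ≤ α₅) (hβ₅ : 0 ≤ β₅) (hδ₅ : 0 ≤ δ₅)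
    (hr₅ : δc + 2 * (α₅ + β₅) * δ₅ ≤ (1 - αC) * δ₃)
    -- FILE 2b's Lemma 2.1 and §3's reading
    (dB : ℕ) {δB αB βB ρ ΛB : ℝ} (hΛB : 1 ≤ ΛB) (hρ : 0 ≤ ρ) (hαB : 0 ≤ αB) (hβB : 0 ≤ βB) (hδB : 0 ≤ δB) (hrB : ρ + (2 * αB + βB) * δB ≤ δc)
    (dW : ℕ) {δW₁ αW₁ δW₂ αW₂ ΛW : ℝ} (hΛW : 0 ≤ ΛW) (hsplit : αW₁ * δW₁ + αW₂ * δW₂ ≤ ρ)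
    -- the junction's constants (named)
    {κQ θQ BX θX BY θY B₁ θC κJ : ℝ} (hκQ : κQ = M₂ * ∑ j, ‖b j‖) (hθQ : θQ = 2 * (8 * ((d : ℝ) + 1) ^ 2 * α₀') * (M₂ * ∑ j, ‖b j‖))
    (hBX : BX = A₁ * (1 + B6.c1 dg δ₀ αg * (θE * A * B6.c1 dg δ₀ αg * (1 - θE * A * B6.c1 dg δ₀ αg)⁻¹)))
    (hθX : θX = BX * θE * A * Λ * B6.c1 db δb βb) (hBY : BY = ((d : ℝ) + 1) * A₂) (hθY : θY = AK * θE * BY * Λ * B6.c1 db δb βb)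
    (hB₁ : B₁ = max KT KK) (hθC : θC = B₁ * B₁ * θF * Λ₄ * B6.c1 d₅ δ₅ β₅ ^ 2)
    (hκJ : κJ = ΛB ^ 4 * B6.c1 dB δB βB ^ 2 *
      (κQ * κQ * θX * B₁ * BY + κQ * θQ * BX * B₁ * BY + κQ * κQ * BX * θC * BY + θQ * κQ * BX * B₁ * BY + κQ * κQ * BX * B₁ * θY))
    (hgeoJ : (Triangle254 (toB6 (geo9K i) Rg Hg) ∧ (∀ y : (geo9K i).Site, (geo9K i).dist y y = 0) ∧
        Ineq261 dg (toB6 (geo9K i) Rg Hg) δ₀ αg ∧ Ineq263 dg (toB6 (geo9K i) Rg Hg) δ₀ αg ∧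
        Ineq261 db (toB6 (geo9K i) Rg Hg) δb βb ∧ ScaleTransfer (geo9K i) δb αb Λ (fun a => (geo9K i).len a) ∧
        ScaleTransfer (geo9K i) δb αb Λ (fun a => (geo9K i).len a ^ 2) ∧
        ScaleTransfer (geo9K i) δ αst C (fun a => (geo9K i).len a ^ 2) ∧ Ineq261 d₁ (toB6 (geo9K i) Rg Hg) ((1 - αst) * δ) α' ∧
        ScaleTransfer (geo9K i) δ₁ αst C (fun a => (geo9K i).len a ^ 2) ∧ Ineq261 d₂ (toB6 (geo9K i) Rg Hg) ((1 - αst) * δ₁) α' ∧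
        ScaleTransfer (geo9K i) δ₂ αst C₄ (fun a => ((geo9K i).len a ^ 4)⁻¹) ∧ Ineq261 d₃ (toB6 (geo9K i) Rg Hg) ((1 - αst) * δ₂) α' ∧
        Ineq261 d₄ (toB6 (geo9K i) Rg Hg) δ₃ αC ∧ Ineq263 d₄ (toB6 (geo9K i) Rg Hg) δ₃ αC ∧
        Ineq261 d₅ (toB6 (geo9K i) Rg Hg) δ₅ β₅ ∧ ScaleTransfer (geo9K i) δ₅ α₅ Λ₄ (fun a => ((geo9K i).len a ^ 4)⁻¹) ∧
        Ineq261 dB (toB6 (geo9K i) Rg Hg) δB βB ∧ ScaleTransfer (geo9K i) δB αB ΛB (fun a => (geo9K i).len a) ∧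
        ScaleTransfer (geo9K i) δB αB ΛB (fun a => ((geo9K i).len a ^ 4)⁻¹) ∧
        ScaleTransfer (geo9K i) δW₁ αW₁ ΛW (fun a => ((geo9K i).len a)⁻¹) ∧ Ineq261 dW (toB6 (geo9K i) Rg Hg) δW₂ αW₂))
    (hdata : (∀ ιB : BlkY i → IBondY i, (∀ s, β i.hN i.D i.hk (ιB s) = s) →
          HasMajorant (g := toB6 (geo9K i) Rg Hg) (fun p : SiteY i × ι => ιB (blkOf i.D.toDomains p.1))
              (conj b ((etaS i ^ 2) • (GpY i (parSymY i) (bgY i U₀)).restrictScalars ℝ))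
              (fun a a' => A * (geo9K i).len a ^ 2 * Real.exp (-(δ₀ * (geo9K i).dist a a'))) ∧
            (∀ μ : Fin (d + 1), HasMajorant (g := toB6 (geo9K i) Rg Hg) (fun p : SiteY i × ι => ιB (blkOf i.D.toDomains p.1))
              (conj b (diffLetter (shiftY i) (UboxY i (bgY i U₀)) ((|i.cf| : ℝ) : ℂ) (Sum.inl μ)) *
                conj b ((etaS i ^ 2) • (GpY i (parSymY i) (bgY i U₀)).restrictScalars ℝ))
              (fun a a' => A₁ * (geo9K i).len a * Real.exp (-(δ₀ * (geo9K i).dist a a')))) ∧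
            (∀ ν : Fin (d + 1), HasMajorant (g := toB6 (geo9K i) Rg Hg) (fun p : SiteY i × ι => ιB (blkOf i.D.toDomains p.1))
              (conj b ((etaS i ^ 2) • (GpY i (parSymY i) (bgY i U₀)).restrictScalars ℝ) *
                conj b (diffLetter (shiftY i) (UboxY i (bgY i U₀)) ((|i.cf| : ℝ) : ℂ) (Sum.inr ν)))
              (fun a a' => A₂ * (geo9K i).len a * Real.exp (-(δ₀ * (geo9K i).dist a a')))) ∧
            HasMajorant (g := toB6 (geo9K i) Rg Hg) (fun q : BlkY i × ι => ιB q.1)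
              (conj b ((etaS i ^ 2 * etaS i ^ 2)⁻¹ • (XinvY i (parSymY i) (GpY i (parSymY i)) (bgY i U₀)).restrictScalars ℝ))
              (fun a a' => KT * ((geo9K i).len a ^ 4)⁻¹ * Real.exp (-(δ₀ * (geo9K i).dist a a'))))) :
    (∀ A, wNormBY i (-3) ((DPDsY i (parSymY i) (GpY i (parSymY i)) (bgY i U₀) - DPDsY i (parKnitY i) (GpY i (parKnitY i)) (bgY i U₀)) A) ≤
        (κJ * (M₂ * ∑ j, ‖b j‖) * ΛW * B6.c1 dW δW₂ αW₂) * wNormBY i (-1) A) := by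
  letI : CStarAlgebra (Matrix (Fin N) (Fin N) ℂ) := {}
  intro A'
  obtain ⟨htri, hrefl, h261g, h263g, h261b, hT1b, hT2b, hST, h261, hST₂, h261₂, hST₃, h261₃, h261₄, h263₄, h261₅, hT4₅, h261B, hT1B, hT4B, hTW, h261W⟩ :=
    hgeoJ
  -- A11's section of the block chart at a member of constant level
  have hsurj := surjective_beta_kIdx_of_constLev i hk hD
  obtain ⟨hGs, hDl, hDr, hT₀⟩ := hdata (Function.surjInv hsurj) (Function.surjInv_eq hsurj)
  -- [B7]'s class (52) at the member's finest scale, one level above the consumer's (1.7)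
  have h52 : pdev (liftCfg (bgY i U₀)) < α₀' * ((((ℓ + 1 : ℕ) : ℝ) ^ i.k)⁻¹) ^ 2 :=
    pdev_liftCfg_bgY_lt_of_inAk i (n := n) (es := 1) (by omega) hper hα0.le hαT hslack hIn
  have hcf' : i.cf = (((ℓ + 1 : ℕ) : ℝ)) ^ i.k := by rw [hk]; exact hcf
  have hU : ∀ μ x, bgY i U₀ μ x ∈ unitaryUnits (Matrix (Fin N) (Fin N) ℂ) := bgY_mem i hU₀
  have hSb : 0 ≤ ∑ j, ‖b j‖ := Finset.sum_nonneg fun _ _ => norm_nonneg _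
  -- 5b at `U = bgY i U₀`, `G = U(N)`
  have hmain := hasMajorant_conj_DPDsY_sub_pars i b (Function.surjInv hsurj) (Rr := Rg) (Hp := Hg) le_rfl
    (avgClosed_unitaryUnits (𝔸 := Matrix (Fin N) (Fin N) ℂ) (d := d + 1) (ℓ + 1))
    hU hα₀ hα₀3 hα₀2 h52 hcf' hM₂ hrepr hA hA₁ hA₂ hK hGs hDl hDr hT₀ htri hrefl dg hαδg hαδg' h261g h263g hθE hAK hsmallg db hΛ hδc hαb hβb hδb hrb
    h261b hT1b hT2b d₁ d₂ d₃ d₄ hδ hδ₁ hδ₂ hδ₃ hC hC₄ hαδ hα'0 hα'1 hδ' hαδ₂ hδ'₂ hαδ₃ hδ'₃ hαC0 hαδ₄ hST h261 hST₂ h261₂ hST₃ h261₃ h261₄ h263₄ hθF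
    hsmall hKK d₅ hΛ₄ hα₅ hβ₅ hδ₅ hr₅ h261₅ hT4₅ dB hΛB hρ hαB hβB hδB hrB h261B hT1B hT4B hκQ hθQ hBX hθX hBY hθY hB₁ hθC hκJ
  have hκJ0 : 0 ≤ κJ := (kappaJ_nonneg (d := d) hα₀.le hM₂ hSb hA hA₁ hA₂ hK hC (c1_nonneg _ _ _) (c1_nonneg _ _ _) (c1_nonneg _ _ _) (c1_nonneg _ _ _)
    hΛ (zero_le_one.trans hΛ₄) hθE hAK hsmallg hθF hκQ hθQ hBX hθX hBY hθY hB₁ hθC hκJ).2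
  exact wNormBY_apply_le_of_hasMajorant b i (Function.surjInv hsurj) (Function.surjInv_eq hsurj) hM₂ hrepr Rg Hg
    ((DPDsY i (parSymY i) (GpY i (parSymY i)) (bgY i U₀) - DPDsY i (parKnitY i) (GpY i (parKnitY i)) (bgY i U₀)).restrictScalars ℝ) hκJ0 hmain dW hΛW
    hTW h261W hsplit A'

end Member

/-! ## §2  FILE 4's binder from the binder with def-Y's-side data -/

section Binder

variable [instF : ∀ i : KIdx d ℓ hd hL 1 1, Fintype (geo9K i).Site] [instD : ∀ i : KIdx d ℓ hd hL 1 1, DecidableEq (geo9K i).Site]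

/-- ★★ **FILE 4's BINDER [(1ₛ) ∧ (Eₛ) ∧ (J at `κ′`)] FROM THE BINDER [(1ₛ) ∧ (Eₛ) ∧ (Dₛ)]**, member by member (§1 at each shape-member; the shape-members'
geometry `hgeoJ` and the windows displayed).  [cite: Balaban1985RegularSpaces, Thm 2 p.83, (1.7) p.77; Balaban1985BackgroundPropagators, (3.25)–(3.27) p.394–395, (3.49) p.399, (3.42) p.397, (3.48) p.398; Balaban1984PropagatorsII, (2.50)–(2.55) p.232, Lemma 2.1 (2.60)–(2.61) p.234; Balaban1985Averaging, (52)–(53) pp.26–27] -/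
theorem jBinder_of_symBinder [Nonempty (Fin N)] {a' K' m K : ℕ} {η aT : ℝ} {Rg : ℝ} {Hg : Prop} {δE BE : ℝ}
    {ι : Type} [Fintype ι] [DecidableEq ι] (b : Module.Basis ι ℝ (Matrix (Fin N) (Fin N) ℂ)) {M₂ : ℝ} (hM₂ : 0 ≤ M₂)
    (hrepr : ∀ (v : (Matrix (Fin N) (Fin N) ℂ)) (j : ι), |b.repr v j| ≤ M₂ * ‖v‖)
    -- the class parameter of [B7] (52) at the members' finest scale, one level above the consumer's (1.7)
    {α₀' : ℝ} (hα₀ : 0 < α₀') (hα₀3 : C0 (d + 1) * α₀' ≤ 1 / 3) (hα₀2 : 2 * α₀' ≤ c2' (d + 1) (ℓ + 1))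
    (hslack : aT * (((ℓ + 1 : ℕ) : ℝ)) ^ (2 * 1) < α₀')
    -- def-Y's-side constants (M5.5: `A, A₁, A₂`; M5.6: `K`) at the rate `δ₀`, and J-B file 9's window
    {δ₀ A A₁ A₂ KT : ℝ} (hA : 0 ≤ A) (hA₁ : 0 ≤ A₁) (hA₂ : 0 ≤ A₂) (hK : 0 ≤ KT)
    (dg : ℕ) {αg : ℝ} (hαδg : 0 ≤ (1 - αg) * δ₀) (hαδg' : 0 ≤ αg * δ₀)
    {θE AK : ℝ} (hθE : θE = 32 * ((d : ℝ) + 1) ^ 2 * α₀' * (M₂ * ∑ j, ‖b j‖))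
    (hAK : AK = A * B6.c1 dg δ₀ αg * (1 - θE * A * B6.c1 dg δ₀ αg)⁻¹) (hsmallg : θE * A * B6.c1 dg δ₀ αg < 1)
    -- the common rate `δ_c` and the entry differences' Lemma 2.1
    (db : ℕ) {δc δb αb βb Λ : ℝ} (hΛ : 0 ≤ Λ) (hδc : 0 ≤ δc) (hαb : 0 ≤ αb) (hβb : 0 ≤ βb) (hδb : 0 ≤ δb)
    (hrb : δc + (αb + βb) * δb ≤ (1 - αg) * δ₀)
    -- 5a's ladder for the `C`-letters
    (d₁ d₂ d₃ d₄ : ℕ) {δ δ₁ δ₂ δ₃ αst α' αC C C₄ : ℝ} (hδ : δ ≤ (1 - αg) * δ₀)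
    (hδ₁ : δ₁ = (1 - α') * ((1 - αst) * δ)) (hδ₂ : δ₂ = (1 - α') * ((1 - αst) * δ₁)) (hδ₃ : δ₃ = (1 - α') * ((1 - αst) * δ₂))
    (hC : 0 ≤ C) (hC₄ : 0 ≤ C₄) (hαδ : 0 ≤ αst * δ) (hα'0 : 0 ≤ α') (hα'1 : α' ≤ 1) (hδ' : 0 ≤ (1 - αst) * δ)
    (hαδ₂ : 0 ≤ αst * δ₁) (hδ'₂ : 0 ≤ (1 - αst) * δ₁) (hαδ₃ : 0 ≤ αst * δ₂) (hδ'₃ : 0 ≤ (1 - αst) * δ₂) (hαC0 : 0 ≤ αC)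
    (hαδ₄ : 0 ≤ (1 - αC) * δ₃)
    {θF : ℝ} (hθF : θF = (2 * (8 * ((d : ℝ) + 1) ^ 2 * α₀') * (M₂ * ∑ j, ‖b j‖)) * (M₂ * ∑ j, ‖b j‖) * (A * A * C * B6.c1 d₁ ((1 - αst) * δ) α') +
          (M₂ * ∑ j, ‖b j‖) * (M₂ * ∑ j, ‖b j‖) * ((A + AK) * (AK * (θE * A) * C * B6.c1 d₁ ((1 - αst) * δ) α') * C * B6.c1 d₂ ((1 - αst) * δ₁) α') +
          (M₂ * ∑ j, ‖b j‖) * ((2 * (8 * ((d : ℝ) + 1) ^ 2 * α₀') * (M₂ * ∑ j, ‖b j‖))) * (AK * AK * C * B6.c1 d₁ ((1 - αst) * δ) α'))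
    (hsmall : θF * KT * C₄ * B6.c1 d₃ ((1 - αst) * δ₂) α' * B6.c1 d₄ δ₃ αC < 1)
    {KK : ℝ} (hKK : KK = KT * B6.c1 d₄ δ₃ αC * (1 - θF * KT * C₄ * B6.c1 d₃ ((1 - αst) * δ₂) α' * B6.c1 d₄ δ₃ αC)⁻¹)
    (d₅ : ℕ) {δ₅ α₅ β₅ Λ₄ : ℝ} (hΛ₄ : 1 ≤ Λ₄) (hα₅ : 0 ≤ α₅) (hβ₅ : 0 ≤ β₅) (hδ₅ : 0 ≤ δ₅)
    (hr₅ : δc + 2 * (α₅ + β₅) * δ₅ ≤ (1 - αC) * δ₃)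
    -- FILE 2b's Lemma 2.1 and §3's reading
    (dB : ℕ) {δB αB βB ρ ΛB : ℝ} (hΛB : 1 ≤ ΛB) (hρ : 0 ≤ ρ) (hαB : 0 ≤ αB) (hβB : 0 ≤ βB) (hδB : 0 ≤ δB) (hrB : ρ + (2 * αB + βB) * δB ≤ δc)
    (dW : ℕ) {δW₁ αW₁ δW₂ αW₂ ΛW : ℝ} (hΛW : 0 ≤ ΛW) (hsplit : αW₁ * δW₁ + αW₂ * δW₂ ≤ ρ)
    -- the junction's constants (named)
    {κQ θQ BX θX BY θY B₁ θC κJ : ℝ} (hκQ : κQ = M₂ * ∑ j, ‖b j‖) (hθQ : θQ = 2 * (8 * ((d : ℝ) + 1) ^ 2 * α₀') * (M₂ * ∑ j, ‖b j‖))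
    (hBX : BX = A₁ * (1 + B6.c1 dg δ₀ αg * (θE * A * B6.c1 dg δ₀ αg * (1 - θE * A * B6.c1 dg δ₀ αg)⁻¹)))
    (hθX : θX = BX * θE * A * Λ * B6.c1 db δb βb) (hBY : BY = ((d : ℝ) + 1) * A₂) (hθY : θY = AK * θE * BY * Λ * B6.c1 db δb βb)
    (hB₁ : B₁ = max KT KK) (hθC : θC = B₁ * B₁ * θF * Λ₄ * B6.c1 d₅ δ₅ β₅ ^ 2)
    (hκJ : κJ = ΛB ^ 4 * B6.c1 dB δB βB ^ 2 *
      (κQ * κQ * θX * B₁ * BY + κQ * θQ * BX * B₁ * BY + κQ * κQ * BX * θC * BY + θQ * κQ * BX * B₁ * BY + κQ * κQ * BX * B₁ * θY))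
    (hgeoJ : ∀ i : KIdx d ℓ hd hL 1 1, i.Mh = (ℓ + 1) ^ a' →
      (Triangle254 (toB6 (geo9K i) Rg Hg) ∧ (∀ y : (geo9K i).Site, (geo9K i).dist y y = 0) ∧
        Ineq261 dg (toB6 (geo9K i) Rg Hg) δ₀ αg ∧ Ineq263 dg (toB6 (geo9K i) Rg Hg) δ₀ αg ∧
        Ineq261 db (toB6 (geo9K i) Rg Hg) δb βb ∧ ScaleTransfer (geo9K i) δb αb Λ (fun a => (geo9K i).len a) ∧
        ScaleTransfer (geo9K i) δb αb Λ (fun a => (geo9K i).len a ^ 2) ∧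
        ScaleTransfer (geo9K i) δ αst C (fun a => (geo9K i).len a ^ 2) ∧ Ineq261 d₁ (toB6 (geo9K i) Rg Hg) ((1 - αst) * δ) α' ∧
        ScaleTransfer (geo9K i) δ₁ αst C (fun a => (geo9K i).len a ^ 2) ∧ Ineq261 d₂ (toB6 (geo9K i) Rg Hg) ((1 - αst) * δ₁) α' ∧
        ScaleTransfer (geo9K i) δ₂ αst C₄ (fun a => ((geo9K i).len a ^ 4)⁻¹) ∧ Ineq261 d₃ (toB6 (geo9K i) Rg Hg) ((1 - αst) * δ₂) α' ∧
        Ineq261 d₄ (toB6 (geo9K i) Rg Hg) δ₃ αC ∧ Ineq263 d₄ (toB6 (geo9K i) Rg Hg) δ₃ αC ∧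
        Ineq261 d₅ (toB6 (geo9K i) Rg Hg) δ₅ β₅ ∧ ScaleTransfer (geo9K i) δ₅ α₅ Λ₄ (fun a => ((geo9K i).len a ^ 4)⁻¹) ∧
        Ineq261 dB (toB6 (geo9K i) Rg Hg) δB βB ∧ ScaleTransfer (geo9K i) δB αB ΛB (fun a => (geo9K i).len a) ∧
        ScaleTransfer (geo9K i) δB αB ΛB (fun a => ((geo9K i).len a ^ 4)⁻¹) ∧
        ScaleTransfer (geo9K i) δW₁ αW₁ ΛW (fun a => ((geo9K i).len a)⁻¹) ∧ Ineq261 dW (toB6 (geo9K i) Rg Hg) δW₂ αW₂))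
    (hΔS : letI : CStarAlgebra (Matrix (Fin N) (Fin N) ℂ) := {}
      ∀ (i : KIdx d ℓ hd hL 1 1) (m' : ℕ), 1 ≤ m' → m' ≤ K' → i.k = m' + 1 → (∀ x, i.D.lev x = m') → i.Mh = (ℓ + 1) ^ a' →
        i.cf = (((ℓ + 1 : ℕ) : ℝ)) ^ (m' + 1) →
        (∀ ι : IBondY i, i.w ι = i.cf ^ 2 * (((((ℓ + 1 : ℕ) : ℝ)) ^ (ι.1.1 : ℕ)) ^ (d + 1) * (1 / (((ℓ + 1 : ℕ) : ℝ)) ^ (ι.1.1 : ℕ)) ^ 2)) →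
        (PV d ℓ i.m i.K hd hL).sitesPerDir 0 = (PV d ℓ m K hd hL).sitesPerDir 0 →
        ∀ (α₀ : ℝ) (U₀ : LSite (d + 1) → Fin (d + 1) → (Matrix (Fin N) (Fin N) ℂ)ˣ),
        (∀ x κ, U₀ x κ ∈ B7Prop2Explicit.unitaryUnits (Matrix (Fin N) (Fin N) ℂ)) →
        IsPeriodic ((PV d ℓ m K hd hL).sitesPerDir 0) U₀ → 0 < α₀ → α₀ ≤ aT →
        InAk (ℓ + 1) m' η α₀ (fun _ => (Set.univ : Set (LSite (d + 1)))) U₀ →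
        IsUnit (deltaAY i (parSymY i) (parBY i) (GpY i (parSymY i)) (bgY i U₀)) ∧
          (∀ (B : B9.Backgrounds) (cfg : B.Cfg → CfgY (Matrix (Fin N) (Fin N) ℂ) i) (par : BondParY (Matrix (Fin N) (Fin N) ℂ) i) (U₁ : B.Cfg),
            cfg U₁ = bgY i U₀ →
            EBlock (kernelFamilyBInv i B cfg (GAY i (parSymY i) (parBY i) (GpY i (parSymY i))) par) BE δE U₁) ∧
        (∀ ιB : BlkY i → IBondY i, (∀ s, β i.hN i.D i.hk (ιB s) = s) →
            HasMajorant (g := toB6 (geo9K i) Rg Hg) (fun p : SiteY i × ι => ιB (blkOf i.D.toDomains p.1))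
                (conj b ((etaS i ^ 2) • (GpY i (parSymY i) (bgY i U₀)).restrictScalars ℝ))
                (fun a a' => A * (geo9K i).len a ^ 2 * Real.exp (-(δ₀ * (geo9K i).dist a a'))) ∧
              (∀ μ : Fin (d + 1), HasMajorant (g := toB6 (geo9K i) Rg Hg) (fun p : SiteY i × ι => ιB (blkOf i.D.toDomains p.1))
                (conj b (diffLetter (shiftY i) (UboxY i (bgY i U₀)) ((|i.cf| : ℝ) : ℂ) (Sum.inl μ)) *
                  conj b ((etaS i ^ 2) • (GpY i (parSymY i) (bgY i U₀)).restrictScalars ℝ))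
                (fun a a' => A₁ * (geo9K i).len a * Real.exp (-(δ₀ * (geo9K i).dist a a')))) ∧
              (∀ ν : Fin (d + 1), HasMajorant (g := toB6 (geo9K i) Rg Hg) (fun p : SiteY i × ι => ιB (blkOf i.D.toDomains p.1))
                (conj b ((etaS i ^ 2) • (GpY i (parSymY i) (bgY i U₀)).restrictScalars ℝ) *
                  conj b (diffLetter (shiftY i) (UboxY i (bgY i U₀)) ((|i.cf| : ℝ) : ℂ) (Sum.inr ν)))
                (fun a a' => A₂ * (geo9K i).len a * Real.exp (-(δ₀ * (geo9K i).dist a a')))) ∧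
              HasMajorant (g := toB6 (geo9K i) Rg Hg) (fun q : BlkY i × ι => ιB q.1)
                (conj b ((etaS i ^ 2 * etaS i ^ 2)⁻¹ • (XinvY i (parSymY i) (GpY i (parSymY i)) (bgY i U₀)).restrictScalars ℝ))
                (fun a a' => KT * ((geo9K i).len a ^ 4)⁻¹ * Real.exp (-(δ₀ * (geo9K i).dist a a'))))) :
    letI : CStarAlgebra (Matrix (Fin N) (Fin N) ℂ) := {}
    ∀ (i : KIdx d ℓ hd hL 1 1) (m' : ℕ), 1 ≤ m' → m' ≤ K' → i.k = m' + 1 → (∀ x, i.D.lev x = m') → i.Mh = (ℓ + 1) ^ a' →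
      i.cf = (((ℓ + 1 : ℕ) : ℝ)) ^ (m' + 1) →
      (∀ ι : IBondY i, i.w ι = i.cf ^ 2 * (((((ℓ + 1 : ℕ) : ℝ)) ^ (ι.1.1 : ℕ)) ^ (d + 1) * (1 / (((ℓ + 1 : ℕ) : ℝ)) ^ (ι.1.1 : ℕ)) ^ 2)) →
      (PV d ℓ i.m i.K hd hL).sitesPerDir 0 = (PV d ℓ m K hd hL).sitesPerDir 0 →
      ∀ (α₀ : ℝ) (U₀ : LSite (d + 1) → Fin (d + 1) → (Matrix (Fin N) (Fin N) ℂ)ˣ),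
      (∀ x κ, U₀ x κ ∈ B7Prop2Explicit.unitaryUnits (Matrix (Fin N) (Fin N) ℂ)) →
      IsPeriodic ((PV d ℓ m K hd hL).sitesPerDir 0) U₀ → 0 < α₀ → α₀ ≤ aT →
      InAk (ℓ + 1) m' η α₀ (fun _ => (Set.univ : Set (LSite (d + 1)))) U₀ →
      IsUnit (deltaAY i (parSymY i) (parBY i) (GpY i (parSymY i)) (bgY i U₀)) ∧
        (∀ (B : B9.Backgrounds) (cfg : B.Cfg → CfgY (Matrix (Fin N) (Fin N) ℂ) i) (par : BondParY (Matrix (Fin N) (Fin N) ℂ) i) (U₁ : B.Cfg),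
          cfg U₁ = bgY i U₀ →
          EBlock (kernelFamilyBInv i B cfg (GAY i (parSymY i) (parBY i) (GpY i (parSymY i))) par) BE δE U₁) ∧
      (∀ A, wNormBY i (-3) ((DPDsY i (parSymY i) (GpY i (parSymY i)) (bgY i U₀) - DPDsY i (parKnitY i) (GpY i (parKnitY i)) (bgY i U₀)) A) ≤
          (κJ * (M₂ * ∑ j, ‖b j‖) * ΛW * B6.c1 dW δW₂ αW₂) * wNormBY i (-1) A) := by
  intro i m' hm1 hmK hk hD hMh hcf hw hPV α₀ U₀ hU₀ hperI hα0 hαT hIn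
  obtain ⟨h1, hE, hdata⟩ := hΔS i m' hm1 hmK hk hD hMh hcf hw hPV α₀ U₀ hU₀ hperI hα0 hαT hIn
  refine ⟨h1, hE, ?_⟩
  have hper : ∀ μ : Fin (d + 1), shiftCfg ((((PV d ℓ i.m i.K hd hL).sitesPerDir 0 : ℕ) : ℤ) • e μ) U₀ = U₀ := by
    rw [hPV]; exact shiftCfg_of_isPeriodic hperI
  exact jAt_of_symData i hk hD hcf hU₀ hper hα0 hαT hIn b hM₂ hrepr hα₀ hα₀3 hα₀2 hslack hA hA₁ hA₂ hK dg hαδg hαδg' hθE hAK hsmallg db hΛ hδc hαb hβb hδb hrb d₁ d₂ d₃ d₄ hδ hδ₁ hδ₂ hδ₃ hC hC₄ hαδ hα'0 hα'1 hδ' hαδ₂ hδ'₂ hαδ₃ hδ'₃ hαC0 hαδ₄ hθF hsmall hKK d₅ hΛ₄ hα₅ hβ₅ hδ₅ hr₅ dB hΛB hρ hαB hβB hδB hrB dW hΛW hsplit hκQ hθQ hBX hθX hBY hθY hB₁ hθC hκJ (hgeoJ i hMh) hdata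

/-- ★★★ **FILE 4 §2 WITH (J) DISCHARGED**: the four (Δa)-members at print's letters `parKnitY` at `2·B_E·c₁(d′,δ_E,1−α)·L⁴` for every shape-member and admissible
background, from [(1ₛ) ∧ (Eₛ) ∧ (Dₛ)], `hgeo`, `hgeoJ` and the windows (the junction window at `κ′ = κ_J·M₂Σ‖b_j‖·Λ_W·c₁`).  HONEST SCOPE: (1ₛ), (Eₛ), (Dₛ), `hgeo`, `hgeoJ`,
windows displayed; YM mass gap NOT proved.  [cite: Balaban1985RegularSpaces, Thm 2 p.83, (1.33)–(1.39) pp.82–83; Balaban1985BackgroundPropagators, p.408 l.30–34, (3.19) p.393, (3.25)–(3.27) p.395, (3.42) p.397, (3.47)–(3.49) pp.398–399, (3.101) p.414, (3.106) p.414; Balaban1984PropagatorsII, (2.50)–(2.55) p.232, Lemma 2.1 (2.60)–(2.61) p.234, (2.66) p.234; Balaban1985Averaging, (52)–(53) pp.26–27] -/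
theorem deltaAFour_of_eBlockSymData [Nonempty (Fin N)] {a' K' m K : ℕ} {η aT : ℝ} (d' : ℕ) {Rg : ℝ} {Hg : Prop} {δE α BE : ℝ} (hBE : 0 ≤ BE)
    (hc1 : 0 ≤ B6.c1 d' δE (1 - α))
    {ι : Type} [Fintype ι] [DecidableEq ι] (b : Module.Basis ι ℝ (Matrix (Fin N) (Fin N) ℂ)) {M₂ : ℝ} (hM₂ : 0 ≤ M₂)
    (hrepr : ∀ (v : (Matrix (Fin N) (Fin N) ℂ)) (j : ι), |b.repr v j| ≤ M₂ * ‖v‖)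
    -- the class parameter of [B7] (52) at the members' finest scale, one level above the consumer's (1.7)
    {α₀' : ℝ} (hα₀ : 0 < α₀') (hα₀3 : C0 (d + 1) * α₀' ≤ 1 / 3) (hα₀2 : 2 * α₀' ≤ c2' (d + 1) (ℓ + 1))
    (hslack : aT * (((ℓ + 1 : ℕ) : ℝ)) ^ (2 * 1) < α₀')
    -- def-Y's-side constants (M5.5: `A, A₁, A₂`; M5.6: `K`) at the rate `δ₀`, and J-B file 9's window
    {δ₀ A A₁ A₂ KT : ℝ} (hA : 0 ≤ A) (hA₁ : 0 ≤ A₁) (hA₂ : 0 ≤ A₂) (hK : 0 ≤ KT)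
    (dg : ℕ) {αg : ℝ} (hαδg : 0 ≤ (1 - αg) * δ₀) (hαδg' : 0 ≤ αg * δ₀)
    {θE AK : ℝ} (hθE : θE = 32 * ((d : ℝ) + 1) ^ 2 * α₀' * (M₂ * ∑ j, ‖b j‖))
    (hAK : AK = A * B6.c1 dg δ₀ αg * (1 - θE * A * B6.c1 dg δ₀ αg)⁻¹) (hsmallg : θE * A * B6.c1 dg δ₀ αg < 1)
    -- the common rate `δ_c` and the entry differences' Lemma 2.1
    (db : ℕ) {δc δb αb βb Λ : ℝ} (hΛ : 0 ≤ Λ) (hδc : 0 ≤ δc) (hαb : 0 ≤ αb) (hβb : 0 ≤ βb) (hδb : 0 ≤ δb)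
    (hrb : δc + (αb + βb) * δb ≤ (1 - αg) * δ₀)
    -- 5a's ladder for the `C`-letters
    (d₁ d₂ d₃ d₄ : ℕ) {δ δ₁ δ₂ δ₃ αst α' αC C C₄ : ℝ} (hδ : δ ≤ (1 - αg) * δ₀)
    (hδ₁ : δ₁ = (1 - α') * ((1 - αst) * δ)) (hδ₂ : δ₂ = (1 - α') * ((1 - αst) * δ₁)) (hδ₃ : δ₃ = (1 - α') * ((1 - αst) * δ₂))
    (hC : 0 ≤ C) (hC₄ : 0 ≤ C₄) (hαδ : 0 ≤ αst * δ) (hα'0 : 0 ≤ α') (hα'1 : α' ≤ 1) (hδ' : 0 ≤ (1 - αst) * δ)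
    (hαδ₂ : 0 ≤ αst * δ₁) (hδ'₂ : 0 ≤ (1 - αst) * δ₁) (hαδ₃ : 0 ≤ αst * δ₂) (hδ'₃ : 0 ≤ (1 - αst) * δ₂) (hαC0 : 0 ≤ αC)
    (hαδ₄ : 0 ≤ (1 - αC) * δ₃)
    {θF : ℝ} (hθF : θF = (2 * (8 * ((d : ℝ) + 1) ^ 2 * α₀') * (M₂ * ∑ j, ‖b j‖)) * (M₂ * ∑ j, ‖b j‖) * (A * A * C * B6.c1 d₁ ((1 - αst) * δ) α') +
          (M₂ * ∑ j, ‖b j‖) * (M₂ * ∑ j, ‖b j‖) * ((A + AK) * (AK * (θE * A) * C * B6.c1 d₁ ((1 - αst) * δ) α') * C * B6.c1 d₂ ((1 - αst) * δ₁) α') +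
          (M₂ * ∑ j, ‖b j‖) * ((2 * (8 * ((d : ℝ) + 1) ^ 2 * α₀') * (M₂ * ∑ j, ‖b j‖))) * (AK * AK * C * B6.c1 d₁ ((1 - αst) * δ) α'))
    (hsmall : θF * KT * C₄ * B6.c1 d₃ ((1 - αst) * δ₂) α' * B6.c1 d₄ δ₃ αC < 1)
    {KK : ℝ} (hKK : KK = KT * B6.c1 d₄ δ₃ αC * (1 - θF * KT * C₄ * B6.c1 d₃ ((1 - αst) * δ₂) α' * B6.c1 d₄ δ₃ αC)⁻¹)
    (d₅ : ℕ) {δ₅ α₅ β₅ Λ₄ : ℝ} (hΛ₄ : 1 ≤ Λ₄) (hα₅ : 0 ≤ α₅) (hβ₅ : 0 ≤ β₅) (hδ₅ : 0 ≤ δ₅)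
    (hr₅ : δc + 2 * (α₅ + β₅) * δ₅ ≤ (1 - αC) * δ₃)
    -- FILE 2b's Lemma 2.1 and §3's reading
    (dB : ℕ) {δB αB βB ρ ΛB : ℝ} (hΛB : 1 ≤ ΛB) (hρ : 0 ≤ ρ) (hαB : 0 ≤ αB) (hβB : 0 ≤ βB) (hδB : 0 ≤ δB) (hrB : ρ + (2 * αB + βB) * δB ≤ δc)
    (dW : ℕ) {δW₁ αW₁ δW₂ αW₂ ΛW : ℝ} (hΛW : 0 ≤ ΛW) (hsplit : αW₁ * δW₁ + αW₂ * δW₂ ≤ ρ)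
    -- the junction's constants (named)
    {κQ θQ BX θX BY θY B₁ θC κJ : ℝ} (hκQ : κQ = M₂ * ∑ j, ‖b j‖) (hθQ : θQ = 2 * (8 * ((d : ℝ) + 1) ^ 2 * α₀') * (M₂ * ∑ j, ‖b j‖))
    (hBX : BX = A₁ * (1 + B6.c1 dg δ₀ αg * (θE * A * B6.c1 dg δ₀ αg * (1 - θE * A * B6.c1 dg δ₀ αg)⁻¹)))
    (hθX : θX = BX * θE * A * Λ * B6.c1 db δb βb) (hBY : BY = ((d : ℝ) + 1) * A₂) (hθY : θY = AK * θE * BY * Λ * B6.c1 db δb βb)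
    (hB₁ : B₁ = max KT KK) (hθC : θC = B₁ * B₁ * θF * Λ₄ * B6.c1 d₅ δ₅ β₅ ^ 2)
    (hκJ : κJ = ΛB ^ 4 * B6.c1 dB δB βB ^ 2 *
      (κQ * κQ * θX * B₁ * BY + κQ * θQ * BX * B₁ * BY + κQ * κQ * BX * θC * BY + θQ * κQ * BX * B₁ * BY + κQ * κQ * BX * B₁ * θY))
    (hθ : 2 * ((((d : ℝ) + 3) * (BE * B6.c1 d' δE (1 - α) * (((ℓ + 1 : ℕ) : ℝ)) ^ 4)) * (κJ * (M₂ * ∑ j, ‖b j‖) * ΛW * B6.c1 dW δW₂ αW₂)) ≤ 1)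
    (hgeo : ∀ i : KIdx d ℓ hd hL 1 1, i.Mh = (ℓ + 1) ^ a' →
      Ineq260 (toB6 (geo9K i) Rg Hg) δE α ∧ Ineq261 d' (toB6 (geo9K i) Rg Hg) δE (1 - α) ∧
      4 * Real.log (geo9K i).L ≤ α * δE * Rg * (geo9K i).M)
    (hgeoJ : ∀ i : KIdx d ℓ hd hL 1 1, i.Mh = (ℓ + 1) ^ a' →
      (Triangle254 (toB6 (geo9K i) Rg Hg) ∧ (∀ y : (geo9K i).Site, (geo9K i).dist y y = 0) ∧
        Ineq261 dg (toB6 (geo9K i) Rg Hg) δ₀ αg ∧ Ineq263 dg (toB6 (geo9K i) Rg Hg) δ₀ αg ∧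
        Ineq261 db (toB6 (geo9K i) Rg Hg) δb βb ∧ ScaleTransfer (geo9K i) δb αb Λ (fun a => (geo9K i).len a) ∧
        ScaleTransfer (geo9K i) δb αb Λ (fun a => (geo9K i).len a ^ 2) ∧
        ScaleTransfer (geo9K i) δ αst C (fun a => (geo9K i).len a ^ 2) ∧ Ineq261 d₁ (toB6 (geo9K i) Rg Hg) ((1 - αst) * δ) α' ∧
        ScaleTransfer (geo9K i) δ₁ αst C (fun a => (geo9K i).len a ^ 2) ∧ Ineq261 d₂ (toB6 (geo9K i) Rg Hg) ((1 - αst) * δ₁) α' ∧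
        ScaleTransfer (geo9K i) δ₂ αst C₄ (fun a => ((geo9K i).len a ^ 4)⁻¹) ∧ Ineq261 d₃ (toB6 (geo9K i) Rg Hg) ((1 - αst) * δ₂) α' ∧
        Ineq261 d₄ (toB6 (geo9K i) Rg Hg) δ₃ αC ∧ Ineq263 d₄ (toB6 (geo9K i) Rg Hg) δ₃ αC ∧
        Ineq261 d₅ (toB6 (geo9K i) Rg Hg) δ₅ β₅ ∧ ScaleTransfer (geo9K i) δ₅ α₅ Λ₄ (fun a => ((geo9K i).len a ^ 4)⁻¹) ∧
        Ineq261 dB (toB6 (geo9K i) Rg Hg) δB βB ∧ ScaleTransfer (geo9K i) δB αB ΛB (fun a => (geo9K i).len a) ∧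
        ScaleTransfer (geo9K i) δB αB ΛB (fun a => ((geo9K i).len a ^ 4)⁻¹) ∧
        ScaleTransfer (geo9K i) δW₁ αW₁ ΛW (fun a => ((geo9K i).len a)⁻¹) ∧ Ineq261 dW (toB6 (geo9K i) Rg Hg) δW₂ αW₂))
    (hΔS : letI : CStarAlgebra (Matrix (Fin N) (Fin N) ℂ) := {}
      ∀ (i : KIdx d ℓ hd hL 1 1) (m' : ℕ), 1 ≤ m' → m' ≤ K' → i.k = m' + 1 → (∀ x, i.D.lev x = m') → i.Mh = (ℓ + 1) ^ a' →
        i.cf = (((ℓ + 1 : ℕ) : ℝ)) ^ (m' + 1) →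
        (∀ ι : IBondY i, i.w ι = i.cf ^ 2 * (((((ℓ + 1 : ℕ) : ℝ)) ^ (ι.1.1 : ℕ)) ^ (d + 1) * (1 / (((ℓ + 1 : ℕ) : ℝ)) ^ (ι.1.1 : ℕ)) ^ 2)) →
        (PV d ℓ i.m i.K hd hL).sitesPerDir 0 = (PV d ℓ m K hd hL).sitesPerDir 0 →
        ∀ (α₀ : ℝ) (U₀ : LSite (d + 1) → Fin (d + 1) → (Matrix (Fin N) (Fin N) ℂ)ˣ),
        (∀ x κ, U₀ x κ ∈ B7Prop2Explicit.unitaryUnits (Matrix (Fin N) (Fin N) ℂ)) →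
        IsPeriodic ((PV d ℓ m K hd hL).sitesPerDir 0) U₀ → 0 < α₀ → α₀ ≤ aT →
        InAk (ℓ + 1) m' η α₀ (fun _ => (Set.univ : Set (LSite (d + 1)))) U₀ →
        IsUnit (deltaAY i (parSymY i) (parBY i) (GpY i (parSymY i)) (bgY i U₀)) ∧
          (∀ (B : B9.Backgrounds) (cfg : B.Cfg → CfgY (Matrix (Fin N) (Fin N) ℂ) i) (par : BondParY (Matrix (Fin N) (Fin N) ℂ) i) (U₁ : B.Cfg),
            cfg U₁ = bgY i U₀ →
            EBlock (kernelFamilyBInv i B cfg (GAY i (parSymY i) (parBY i) (GpY i (parSymY i))) par) BE δE U₁) ∧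
        (∀ ιB : BlkY i → IBondY i, (∀ s, β i.hN i.D i.hk (ιB s) = s) →
            HasMajorant (g := toB6 (geo9K i) Rg Hg) (fun p : SiteY i × ι => ιB (blkOf i.D.toDomains p.1))
                (conj b ((etaS i ^ 2) • (GpY i (parSymY i) (bgY i U₀)).restrictScalars ℝ))
                (fun a a' => A * (geo9K i).len a ^ 2 * Real.exp (-(δ₀ * (geo9K i).dist a a'))) ∧
              (∀ μ : Fin (d + 1), HasMajorant (g := toB6 (geo9K i) Rg Hg) (fun p : SiteY i × ι => ιB (blkOf i.D.toDomains p.1))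
                (conj b (diffLetter (shiftY i) (UboxY i (bgY i U₀)) ((|i.cf| : ℝ) : ℂ) (Sum.inl μ)) *
                  conj b ((etaS i ^ 2) • (GpY i (parSymY i) (bgY i U₀)).restrictScalars ℝ))
                (fun a a' => A₁ * (geo9K i).len a * Real.exp (-(δ₀ * (geo9K i).dist a a')))) ∧
              (∀ ν : Fin (d + 1), HasMajorant (g := toB6 (geo9K i) Rg Hg) (fun p : SiteY i × ι => ιB (blkOf i.D.toDomains p.1))
                (conj b ((etaS i ^ 2) • (GpY i (parSymY i) (bgY i U₀)).restrictScalars ℝ) *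
                  conj b (diffLetter (shiftY i) (UboxY i (bgY i U₀)) ((|i.cf| : ℝ) : ℂ) (Sum.inr ν)))
                (fun a a' => A₂ * (geo9K i).len a * Real.exp (-(δ₀ * (geo9K i).dist a a')))) ∧
              HasMajorant (g := toB6 (geo9K i) Rg Hg) (fun q : BlkY i × ι => ιB q.1)
                (conj b ((etaS i ^ 2 * etaS i ^ 2)⁻¹ • (XinvY i (parSymY i) (GpY i (parSymY i)) (bgY i U₀)).restrictScalars ℝ))
                (fun a a' => KT * ((geo9K i).len a ^ 4)⁻¹ * Real.exp (-(δ₀ * (geo9K i).dist a a'))))) :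
    letI : CStarAlgebra (Matrix (Fin N) (Fin N) ℂ) := {}
    ∀ (i : KIdx d ℓ hd hL 1 1) (m' : ℕ), 1 ≤ m' → m' ≤ K' → i.k = m' + 1 → (∀ x, i.D.lev x = m') → i.Mh = (ℓ + 1) ^ a' →
      i.cf = (((ℓ + 1 : ℕ) : ℝ)) ^ (m' + 1) →
      (∀ ι : IBondY i, i.w ι = i.cf ^ 2 * (((((ℓ + 1 : ℕ) : ℝ)) ^ (ι.1.1 : ℕ)) ^ (d + 1) * (1 / (((ℓ + 1 : ℕ) : ℝ)) ^ (ι.1.1 : ℕ)) ^ 2)) →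
      (PV d ℓ i.m i.K hd hL).sitesPerDir 0 = (PV d ℓ m K hd hL).sitesPerDir 0 →
      ∀ (α₀ : ℝ) (U₀ : LSite (d + 1) → Fin (d + 1) → (Matrix (Fin N) (Fin N) ℂ)ˣ),
      (∀ x κ, U₀ x κ ∈ B7Prop2Explicit.unitaryUnits (Matrix (Fin N) (Fin N) ℂ)) →
      IsPeriodic ((PV d ℓ m K hd hL).sitesPerDir 0) U₀ → 0 < α₀ → α₀ ≤ aT →
      InAk (ℓ + 1) m' η α₀ (fun _ => (Set.univ : Set (LSite (d + 1)))) U₀ →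
        IsUnit (deltaAY i (parKnitY i) (parBY i) (GpY i (parKnitY i)) (bgY i U₀)) ∧
        (∀ F, wNormBY i (-1) (GAY i (parKnitY i) (parBY i) (GpY i (parKnitY i)) (bgY i U₀) F) ≤
          (2 * (BE * B6.c1 d' δE (1 - α) * (((ℓ + 1 : ℕ) : ℝ)) ^ 4)) * wNormBY i (-3) F) ∧
        (∀ F ν, wNormBY i (-2) (cdB i (bgY i U₀) ν (GAY i (parKnitY i) (parBY i) (GpY i (parKnitY i)) (bgY i U₀) F)) ≤
          (2 * (BE * B6.c1 d' δE (1 - α) * (((ℓ + 1 : ℕ) : ℝ)) ^ 4)) * wNormBY i (-3) F) ∧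
        (∀ F, wNormBY i (-3) (lapB i (bgY i U₀) (GAY i (parKnitY i) (parBY i) (GpY i (parKnitY i)) (bgY i U₀) F)) ≤
          (2 * (BE * B6.c1 d' δE (1 - α) * (((ℓ + 1 : ℕ) : ℝ)) ^ 4)) * wNormBY i (-3) F) := by
  letI : CStarAlgebra (Matrix (Fin N) (Fin N) ℂ) := {}
  have hSb : 0 ≤ ∑ j, ‖b j‖ := Finset.sum_nonneg fun _ _ => norm_nonneg _
  have hκJ0 : 0 ≤ κJ := (kappaJ_nonneg (d := d) hα₀.le hM₂ hSb hA hA₁ hA₂ hK hC (c1_nonneg _ _ _) (c1_nonneg _ _ _) (c1_nonneg _ _ _) (c1_nonneg _ _ _)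
    hΛ (zero_le_one.trans hΛ₄) hθE hAK hsmallg hθF hκQ hθQ hBX hθX hBY hθY hB₁ hθC hκJ).2
  have hκ' : 0 ≤ (κJ * (M₂ * ∑ j, ‖b j‖) * ΛW * B6.c1 dW δW₂ αW₂) := mul_nonneg (mul_nonneg (mul_nonneg hκJ0 (mul_nonneg hM₂ hSb)) hΛW) (c1_nonneg _ _ _)
  exact deltaAFour_of_eBlockSym (instF := instF) d' hBE hκ' hc1 hθ hgeo
    (jBinder_of_symBinder (instF := instF) (instD := instD) b hM₂ hrepr hα₀ hα₀3 hα₀2 hslack hA hA₁ hA₂ hK dg hαδg hαδg' hθE hAK hsmallg db hΛ hδc hαb hβb hδb hrb d₁ d₂ d₃ d₄ hδ hδ₁ hδ₂ hδ₃ hC hC₄ hαδ hα'0 hα'1 hδ' hαδ₂ hδ'₂ hαδ₃ hδ'₃ hαC0 hαδ₄ hθF hsmall hKK d₅ hΛ₄ hα₅ hβ₅ hδ₅ hr₅ dB hΛB hρ hαB hβB hδB hrB dW hΛW hsplit hκQ hθQ hBX hθX hBY hθY hB₁ hθC hκJ hgeoJ hΔS)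

end Binder

/-! ## §4 ★★★★★ The interface of record with the binder AT `parSymY` and (J) discharged: `d + 1 = 3`, `SU(2)` -/

section Cover

open B8Thm2T3FamilyBinder (P_eq_PV)
open T3ContinuumYM3Torus (T3Family)
open T3SectALandauChart (eta eta_pos)

variable {hd₃ : 1 ≤ 2 + 1}
variable [instF : ∀ i : KIdx 2 ℓ hd₃ hL 1 1, Fintype (geo9K i).Site] [instD : ∀ i : KIdx 2 ℓ hd₃ hL 1 1, DecidableEq (geo9K i).Site]

/-- ★★★★★ **THE TORUS THM 2 INTERFACE OF RECORD WITH THE BINDER AT `parSymY`, (J) DISCHARGED** (`d + 1 = 3`, `N = 2`): for `τ = tr`, `M ≥ 1`, the E-block data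
`(d′, δ_E, α, B_E)` with FILE 4's windows at `B₀ := 2·B_E·c₁(d′,δ_E,1−α)·L⁴` and the junction window at `κ′ = κ_J·M₂Σ‖b_j‖·Λ_W·c₁(d_W,δ_W₂,α_W₂)`, the class
parameter `α₀′` one level above `a_T` (`a_T·L² < α₀′`), def-Y's-side constants `(δ₀, A, A₁, A₂, K)`, the junction's ladder data and windows, a basis `b`, `Rr, Hp`,
`(Rg, Hg)` with `hgeo` and `hgeoJ` for the members with `i.Mh = L^{a′}`: `∃ a₀′ > 0, ∃ k₀, ∃ c_α > 0, ∀ c_L …, ∃ B₁ B₂ c₁ > 0, ∀ F : T3Family, F.L = ℓ + 1 → ∀ n < K`,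
[(1ₛ) ∧ (Eₛ) ∧ (Dₛ) at the cover torus' shape-members] → `P ∣ P′ ∧ L^{K−n} ∣ P ∧ Thm2TorusAt (ℓ+1) (K − n) P′ (eta F n K) 0 B₁ B₂ c₁ len SU(2) ⊤` — FILE 4 §4 with (J)
replaced by def-Y's-side data (Dₛ) (M5.5 ∕ M5.6 output shapes; suppliers: p33's lineage) — so the interface displays M5.7's endpoint (1ₛ) ∧ (Eₛ) and M5.5 ∕ M5.6's
(Dₛ) at `parSymY` ALONE.  HONEST SCOPE: (1ₛ), (Eₛ), (Dₛ), `hgeo`, `hgeoJ`, windows displayed; `stub_PV3A` NOT discharged; no summit ∕ node statement proved; nothing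
continuum ∕ ℝ⁴ ∕ OS — the Yang–Mills mass gap is NOT proved by any of this.
[cite: Balaban1985RegularSpaces, Thm 2 p.83, (1.29) p.81, (1.33)–(1.39) pp.82–83, (1.7) p.77, (1.58)–(1.60) pp.86–87; Balaban1985BackgroundPropagators, p.408 l.30–34, (3.19) p.393, (3.25)–(3.27) p.394–395, (3.40)–(3.42) p.397, (3.47)–(3.49) pp.398–399, Thm 3.3 p.399, (3.101) p.414, (3.106) p.414, Thm 3.11 p.416; Balaban1984PropagatorsII, (2.50)–(2.55) p.232, Lemma 2.1 (2.60)–(2.61) p.234, (2.66) p.234; Balaban1985Averaging, (52)–(53) pp.26–27; Balaban1985UV3, (1)–(3) p.256] -/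
theorem hThm2Cover_of_prop6_eBlockSymData (hℓ : 4 ≤ ℓ)
    (τ : (Matrix (Fin 2) (Fin 2) ℂ) →ₗ[ℂ] ℂ) (hτ : ∀ a, τ a = Matrix.trace a) (hτt : ∀ a b, τ (a * b) = τ (b * a))
    {Cτ : ℝ} (hCτ : ∀ x y : (Matrix (Fin 2) (Fin 2) ℂ), |(τ (star x * y)).re| ≤ Cτ * ‖x‖ * ‖y‖)
    {M : ℝ} (hM1 : 1 ≤ M) (d' : ℕ) {Rg : ℝ} {Hg : Prop} {δE α BE aT : ℝ} (hBE : 0 < BE) (hδE : 0 < δE) (hα1 : α < 1)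
    (haT : 0 < aT) (haTQ : aT ≤ alphaQ (2 + 1) (ℓ + 1) / ((ℓ + 1 : ℕ) : ℝ) ^ 2)
    (haT3 : C0 (2 + 1) * aT ≤ 1 / 3) (haT2 : 2 * aT ≤ c2' (2 + 1) (ℓ + 1))
    (hεB : 2 * ((48 * (((2 : ℕ) : ℝ) + 1) + 14 * ((2 : ℕ) : ℝ) * M + (32 * (((2 : ℕ) : ℝ) + 2) ^ 2 +
        12 * (((2 : ℕ) : ℝ) + 1) ^ 2 * (13344 * (((2 : ℕ) : ℝ) + 1) * (((2 : ℕ) : ℝ) + 2) ^ 2 * (((2 : ℕ) : ℝ) + 5) * (((ℓ + 1 : ℕ) : ℝ)) ^ (2 + 4)) *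
          (Cτ * (letI : CStarAlgebra (Matrix (Fin 2) (Fin 2) ℂ) := {}; betaTau τ)))) * aT) * (2 * (BE * B6.c1 d' δE (1 - α) * (((ℓ + 1 : ℕ) : ℝ)) ^ 4)) ≤ 1)
    {len : LSite (2 + 1) → ℝ}
    {ι : Type} [Fintype ι] [DecidableEq ι] (b : Module.Basis ι ℝ (Matrix (Fin 2) (Fin 2) ℂ)) {M₂ : ℝ} (hM₂ : 0 ≤ M₂)
    (hrepr : ∀ (v : (Matrix (Fin 2) (Fin 2) ℂ)) (j : ι), |b.repr v j| ≤ M₂ * ‖v‖)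
    (Rr : ℝ) (Hp : Prop) {a' : ℕ} (h8' : 8 ≤ (ℓ + 1) ^ a')
    -- the class parameter of [B7] (52) at the members' finest scale, one level above the consumer's (1.7)
    {α₀' : ℝ} (hα₀ : 0 < α₀') (hα₀3 : C0 (2 + 1) * α₀' ≤ 1 / 3) (hα₀2 : 2 * α₀' ≤ c2' (2 + 1) (ℓ + 1))
    (hslack : aT * (((ℓ + 1 : ℕ) : ℝ)) ^ (2 * 1) < α₀')
    -- def-Y's-side constants (M5.5: `A, A₁, A₂`; M5.6: `K`) at the rate `δ₀`, and J-B file 9's window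
    {δ₀ A A₁ A₂ KT : ℝ} (hA : 0 ≤ A) (hA₁ : 0 ≤ A₁) (hA₂ : 0 ≤ A₂) (hK : 0 ≤ KT)
    (dg : ℕ) {αg : ℝ} (hαδg : 0 ≤ (1 - αg) * δ₀) (hαδg' : 0 ≤ αg * δ₀)
    {θE AK : ℝ} (hθE : θE = 32 * (((2 : ℕ) : ℝ) + 1) ^ 2 * α₀' * (M₂ * ∑ j, ‖b j‖))
    (hAK : AK = A * B6.c1 dg δ₀ αg * (1 - θE * A * B6.c1 dg δ₀ αg)⁻¹) (hsmallg : θE * A * B6.c1 dg δ₀ αg < 1)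
    -- the common rate `δ_c` and the entry differences' Lemma 2.1
    (db : ℕ) {δc δb αb βb Λ : ℝ} (hΛ : 0 ≤ Λ) (hδc : 0 ≤ δc) (hαb : 0 ≤ αb) (hβb : 0 ≤ βb) (hδb : 0 ≤ δb)
    (hrb : δc + (αb + βb) * δb ≤ (1 - αg) * δ₀)
    -- 5a's ladder for the `C`-letters
    (d₁ d₂ d₃ d₄ : ℕ) {δ δ₁ δ₂ δ₃ αst α' αC C C₄ : ℝ} (hδ : δ ≤ (1 - αg) * δ₀)
    (hδ₁ : δ₁ = (1 - α') * ((1 - αst) * δ)) (hδ₂ : δ₂ = (1 - α') * ((1 - αst) * δ₁)) (hδ₃ : δ₃ = (1 - α') * ((1 - αst) * δ₂))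
    (hC : 0 ≤ C) (hC₄ : 0 ≤ C₄) (hαδ : 0 ≤ αst * δ) (hα'0 : 0 ≤ α') (hα'1 : α' ≤ 1) (hδ' : 0 ≤ (1 - αst) * δ)
    (hαδ₂ : 0 ≤ αst * δ₁) (hδ'₂ : 0 ≤ (1 - αst) * δ₁) (hαδ₃ : 0 ≤ αst * δ₂) (hδ'₃ : 0 ≤ (1 - αst) * δ₂) (hαC0 : 0 ≤ αC)
    (hαδ₄ : 0 ≤ (1 - αC) * δ₃)
    {θF : ℝ} (hθF : θF = (2 * (8 * (((2 : ℕ) : ℝ) + 1) ^ 2 * α₀') * (M₂ * ∑ j, ‖b j‖)) * (M₂ * ∑ j, ‖b j‖) * (A * A * C * B6.c1 d₁ ((1 - αst) * δ) α') +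
          (M₂ * ∑ j, ‖b j‖) * (M₂ * ∑ j, ‖b j‖) * ((A + AK) * (AK * (θE * A) * C * B6.c1 d₁ ((1 - αst) * δ) α') * C * B6.c1 d₂ ((1 - αst) * δ₁) α') +
          (M₂ * ∑ j, ‖b j‖) * ((2 * (8 * (((2 : ℕ) : ℝ) + 1) ^ 2 * α₀') * (M₂ * ∑ j, ‖b j‖))) * (AK * AK * C * B6.c1 d₁ ((1 - αst) * δ) α'))
    (hsmall : θF * KT * C₄ * B6.c1 d₃ ((1 - αst) * δ₂) α' * B6.c1 d₄ δ₃ αC < 1)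
    {KK : ℝ} (hKK : KK = KT * B6.c1 d₄ δ₃ αC * (1 - θF * KT * C₄ * B6.c1 d₃ ((1 - αst) * δ₂) α' * B6.c1 d₄ δ₃ αC)⁻¹)
    (d₅ : ℕ) {δ₅ α₅ β₅ Λ₄ : ℝ} (hΛ₄ : 1 ≤ Λ₄) (hα₅ : 0 ≤ α₅) (hβ₅ : 0 ≤ β₅) (hδ₅ : 0 ≤ δ₅)
    (hr₅ : δc + 2 * (α₅ + β₅) * δ₅ ≤ (1 - αC) * δ₃)
    -- FILE 2b's Lemma 2.1 and §3's reading
    (dB : ℕ) {δB αB βB ρ ΛB : ℝ} (hΛB : 1 ≤ ΛB) (hρ : 0 ≤ ρ) (hαB : 0 ≤ αB) (hβB : 0 ≤ βB) (hδB : 0 ≤ δB) (hrB : ρ + (2 * αB + βB) * δB ≤ δc)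
    (dW : ℕ) {δW₁ αW₁ δW₂ αW₂ ΛW : ℝ} (hΛW : 0 ≤ ΛW) (hsplit : αW₁ * δW₁ + αW₂ * δW₂ ≤ ρ)
    -- the junction's constants (named)
    {κQ θQ BX θX BY θY B₁ θC κJ : ℝ} (hκQ : κQ = M₂ * ∑ j, ‖b j‖) (hθQ : θQ = 2 * (8 * (((2 : ℕ) : ℝ) + 1) ^ 2 * α₀') * (M₂ * ∑ j, ‖b j‖))
    (hBX : BX = A₁ * (1 + B6.c1 dg δ₀ αg * (θE * A * B6.c1 dg δ₀ αg * (1 - θE * A * B6.c1 dg δ₀ αg)⁻¹)))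
    (hθX : θX = BX * θE * A * Λ * B6.c1 db δb βb) (hBY : BY = (((2 : ℕ) : ℝ) + 1) * A₂) (hθY : θY = AK * θE * BY * Λ * B6.c1 db δb βb)
    (hB₁ : B₁ = max KT KK) (hθC : θC = B₁ * B₁ * θF * Λ₄ * B6.c1 d₅ δ₅ β₅ ^ 2)
    (hκJ : κJ = ΛB ^ 4 * B6.c1 dB δB βB ^ 2 *
      (κQ * κQ * θX * B₁ * BY + κQ * θQ * BX * B₁ * BY + κQ * κQ * BX * θC * BY + θQ * κQ * BX * B₁ * BY + κQ * κQ * BX * B₁ * θY))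
    (hθ : 2 * (((((2 : ℕ) : ℝ) + 3) * (BE * B6.c1 d' δE (1 - α) * (((ℓ + 1 : ℕ) : ℝ)) ^ 4)) * (κJ * (M₂ * ∑ j, ‖b j‖) * ΛW * B6.c1 dW δW₂ αW₂)) ≤ 1)
    (hgeo : ∀ i : KIdx 2 ℓ hd₃ hL 1 1, i.Mh = (ℓ + 1) ^ a' →
      Ineq260 (toB6 (geo9K i) Rg Hg) δE α ∧ Ineq261 d' (toB6 (geo9K i) Rg Hg) δE (1 - α) ∧
      4 * Real.log (geo9K i).L ≤ α * δE * Rg * (geo9K i).M)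
    (hgeoJ : ∀ i : KIdx 2 ℓ hd₃ hL 1 1, i.Mh = (ℓ + 1) ^ a' →
      (Triangle254 (toB6 (geo9K i) Rg Hg) ∧ (∀ y : (geo9K i).Site, (geo9K i).dist y y = 0) ∧
        Ineq261 dg (toB6 (geo9K i) Rg Hg) δ₀ αg ∧ Ineq263 dg (toB6 (geo9K i) Rg Hg) δ₀ αg ∧
        Ineq261 db (toB6 (geo9K i) Rg Hg) δb βb ∧ ScaleTransfer (geo9K i) δb αb Λ (fun a => (geo9K i).len a) ∧
        ScaleTransfer (geo9K i) δb αb Λ (fun a => (geo9K i).len a ^ 2) ∧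
        ScaleTransfer (geo9K i) δ αst C (fun a => (geo9K i).len a ^ 2) ∧ Ineq261 d₁ (toB6 (geo9K i) Rg Hg) ((1 - αst) * δ) α' ∧
        ScaleTransfer (geo9K i) δ₁ αst C (fun a => (geo9K i).len a ^ 2) ∧ Ineq261 d₂ (toB6 (geo9K i) Rg Hg) ((1 - αst) * δ₁) α' ∧
        ScaleTransfer (geo9K i) δ₂ αst C₄ (fun a => ((geo9K i).len a ^ 4)⁻¹) ∧ Ineq261 d₃ (toB6 (geo9K i) Rg Hg) ((1 - αst) * δ₂) α' ∧
        Ineq261 d₄ (toB6 (geo9K i) Rg Hg) δ₃ αC ∧ Ineq263 d₄ (toB6 (geo9K i) Rg Hg) δ₃ αC ∧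
        Ineq261 d₅ (toB6 (geo9K i) Rg Hg) δ₅ β₅ ∧ ScaleTransfer (geo9K i) δ₅ α₅ Λ₄ (fun a => ((geo9K i).len a ^ 4)⁻¹) ∧
        Ineq261 dB (toB6 (geo9K i) Rg Hg) δB βB ∧ ScaleTransfer (geo9K i) δB αB ΛB (fun a => (geo9K i).len a) ∧
        ScaleTransfer (geo9K i) δB αB ΛB (fun a => ((geo9K i).len a ^ 4)⁻¹) ∧
        ScaleTransfer (geo9K i) δW₁ αW₁ ΛW (fun a => ((geo9K i).len a)⁻¹) ∧ Ineq261 dW (toB6 (geo9K i) Rg Hg) δW₂ αW₂)) :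
    letI : CStarAlgebra (Matrix (Fin 2) (Fin 2) ℂ) := {}
    ∃ a₀' : ℝ, 0 < a₀' ∧ ∃ k₀ : ℕ, ∃ cα : ℝ, 0 < cα ∧
    ∀ cL : ℝ, 0 < cL → cL * (((ℓ + 1 : ℕ) : ℝ)) ^ 2 < a₀' →
      cL ≤ min (1 / 16) (min aT (min aT (1 / (2 * (2 * (2 * (BE * B6.c1 d' δE (1 - α) * (((ℓ + 1 : ℕ) : ℝ)) ^ 4))) * (14 * ((2 + 1 - 1 : ℕ) : ℝ)) * M + 1)))) →
      cL ≤ cα →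
    ∃ B₁' B₂ c₁ : ℝ, 0 < B₁' ∧ 0 < B₂ ∧ 0 < c₁ ∧
    ∀ F : T3Family, F.L = ℓ + 1 → ∀ (n K : ℕ), n < K →
      (∀ (i : KIdx 2 ℓ hd₃ hL 1 1) (m' : ℕ), 1 ≤ m' → m' ≤ K - n → i.k = m' + 1 → (∀ x, i.D.lev x = m') → i.Mh = (ℓ + 1) ^ a' →
        i.cf = (((ℓ + 1 : ℕ) : ℝ)) ^ (m' + 1) →
        (∀ ι : IBondY i, i.w ι = i.cf ^ 2 * (((((ℓ + 1 : ℕ) : ℝ)) ^ (ι.1.1 : ℕ)) ^ (2 + 1) * (1 / (((ℓ + 1 : ℕ) : ℝ)) ^ (ι.1.1 : ℕ)) ^ 2)) →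
        (PV 2 ℓ i.m i.K hd₃ hL).sitesPerDir 0 = (PV 2 ℓ (F.m + k₀) K hd₃ hL).sitesPerDir 0 →
        ∀ (α₀ : ℝ) (U₀ : LSite (2 + 1) → Fin (2 + 1) → (Matrix (Fin 2) (Fin 2) ℂ)ˣ),
        (∀ x κ, U₀ x κ ∈ B7Prop2Explicit.unitaryUnits (Matrix (Fin 2) (Fin 2) ℂ)) →
        IsPeriodic ((PV 2 ℓ (F.m + k₀) K hd₃ hL).sitesPerDir 0) U₀ → 0 < α₀ → α₀ ≤ aT →
        InAk (ℓ + 1) m' (eta F n K) α₀ (fun _ => (Set.univ : Set (LSite (2 + 1)))) U₀ →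
          IsUnit (deltaAY i (parSymY i) (parBY i) (GpY i (parSymY i)) (bgY i U₀)) ∧
          (∀ (B : B9.Backgrounds) (cfg : B.Cfg → CfgY (Matrix (Fin 2) (Fin 2) ℂ) i) (par : BondParY (Matrix (Fin 2) (Fin 2) ℂ) i) (U₁ : B.Cfg),
            cfg U₁ = bgY i U₀ →
            EBlock (kernelFamilyBInv i B cfg (GAY i (parSymY i) (parBY i) (GpY i (parSymY i))) par) BE δE U₁) ∧
          (∀ ιB : BlkY i → IBondY i, (∀ s, β i.hN i.D i.hk (ιB s) = s) →
              HasMajorant (g := toB6 (geo9K i) Rg Hg) (fun p : SiteY i × ι => ιB (blkOf i.D.toDomains p.1))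
                  (conj b ((etaS i ^ 2) • (GpY i (parSymY i) (bgY i U₀)).restrictScalars ℝ))
                  (fun a a' => A * (geo9K i).len a ^ 2 * Real.exp (-(δ₀ * (geo9K i).dist a a'))) ∧
                (∀ μ : Fin (2 + 1), HasMajorant (g := toB6 (geo9K i) Rg Hg) (fun p : SiteY i × ι => ιB (blkOf i.D.toDomains p.1))
                  (conj b (diffLetter (shiftY i) (UboxY i (bgY i U₀)) ((|i.cf| : ℝ) : ℂ) (Sum.inl μ)) *
                    conj b ((etaS i ^ 2) • (GpY i (parSymY i) (bgY i U₀)).restrictScalars ℝ))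
                  (fun a a' => A₁ * (geo9K i).len a * Real.exp (-(δ₀ * (geo9K i).dist a a')))) ∧
                (∀ ν : Fin (2 + 1), HasMajorant (g := toB6 (geo9K i) Rg Hg) (fun p : SiteY i × ι => ιB (blkOf i.D.toDomains p.1))
                  (conj b ((etaS i ^ 2) • (GpY i (parSymY i) (bgY i U₀)).restrictScalars ℝ) *
                    conj b (diffLetter (shiftY i) (UboxY i (bgY i U₀)) ((|i.cf| : ℝ) : ℂ) (Sum.inr ν)))
                  (fun a a' => A₂ * (geo9K i).len a * Real.exp (-(δ₀ * (geo9K i).dist a a')))) ∧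
                HasMajorant (g := toB6 (geo9K i) Rg Hg) (fun q : BlkY i × ι => ιB q.1)
                  (conj b ((etaS i ^ 2 * etaS i ^ 2)⁻¹ • (XinvY i (parSymY i) (GpY i (parSymY i)) (bgY i U₀)).restrictScalars ℝ))
                  (fun a a' => KT * ((geo9K i).len a ^ 4)⁻¹ * Real.exp (-(δ₀ * (geo9K i).dist a a'))))) →
      (((F.P K).sitesPerDir 0 : ℕ) : ℤ) ∣ (((PV 2 ℓ (F.m + k₀) K hd₃ hL).sitesPerDir 0 : ℕ) : ℤ) ∧
      (((ℓ + 1 : ℕ) : ℤ)) ^ (K - n) ∣ (((F.P K).sitesPerDir 0 : ℕ) : ℤ) ∧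
      Thm2TorusAt (ℓ + 1) (K - n) ((((PV 2 ℓ (F.m + k₀) K hd₃ hL).sitesPerDir 0 : ℕ) : ℤ)) (eta F n K) 0 B₁' B₂ c₁ len
        (specialUnitaryUnits (Fin 2)) (fun _ => True) := by
  letI : CStarAlgebra (Matrix (Fin 2) (Fin 2) ℂ) := {}
  have hSb : 0 ≤ ∑ j, ‖b j‖ := Finset.sum_nonneg fun _ _ => norm_nonneg _
  have hκJ0 : 0 ≤ κJ := (kappaJ_nonneg (d := 2) hα₀.le hM₂ hSb hA hA₁ hA₂ hK hC (c1_nonneg _ _ _) (c1_nonneg _ _ _) (c1_nonneg _ _ _) (c1_nonneg _ _ _)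
    hΛ (zero_le_one.trans hΛ₄) hθE hAK hsmallg hθF hκQ hθQ hBX hθX hBY hθY hB₁ hθC hκJ).2
  have hκ' : 0 ≤ (κJ * (M₂ * ∑ j, ‖b j‖) * ΛW * B6.c1 dW δW₂ αW₂) := mul_nonneg (mul_nonneg (mul_nonneg hκJ0 (mul_nonneg hM₂ hSb)) hΛW) (c1_nonneg _ _ _)
  obtain ⟨a₀', ha₀', k₀, cα, hcα, H⟩ :=
    hThm2Cover_of_prop6_eBlockSym (hd₃ := hd₃) (hL := hL) (len := len) hℓ τ hτ hτt hCτ hM1 d' (Rg := Rg) (Hg := Hg) hBE hδE hα1 hκ' hθ haT haTQ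
      haT3 haT2 hεB b hM₂ hrepr Rr Hp h8' hgeo
  refine ⟨a₀', ha₀', k₀, cα, hcα, fun cL hcL hαe hcLP hcLα => ?_⟩
  obtain ⟨B₁', B₂, c₁, hB₁', hB₂, hc₁, HT⟩ := H cL hcL hαe hcLP hcLα
  exact ⟨B₁', B₂, c₁, hB₁', hB₂, hc₁, fun F hF n K hnK hΔ =>
    HT F hF n K hnK (jBinder_of_symBinder (d := 2) (hd := hd₃) (instF := instF) (instD := instD) b hM₂ hrepr hα₀ hα₀3 hα₀2 hslack hA hA₁ hA₂ hK dg hαδg hαδg' hθE hAK hsmallg db hΛ hδc hαb hβb hδb hrb d₁ d₂ d₃ d₄ hδ hδ₁ hδ₂ hδ₃ hC hC₄ hαδ hα'0 hα'1 hδ' hαδ₂ hδ'₂ hαδ₃ hδ'₃ hαC0 hαδ₄ hθF hsmall hKK d₅ hΛ₄ hα₅ hβ₅ hδ₅ hr₅ dB hΛB hρ hαB hβB hδB hrB dW hΛW hsplit hκQ hθQ hBX hθX hBY hθY hB₁ hθC hκJ hgeoJ hΔ)⟩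

end Cover

end Literature.MathematicalPhysics.QuantumFieldTheory.Balaban1983to89.B8Thm2TorusCoverOfEBlockSymJ

end
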